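import Summits.ResolutionOfSingularities.ResolutionOfSingularities.Theorems.FrobeniusLadderFInjectiveMacaulayficationProp44T1Glue
import Literature.AlgebraicGeometry.Resolution.CurveStepChartData
import Literature.AlgebraicGeometry.Resolution.TauOneAdaptedCoordinates
import Literature.AlgebraicGeometry.Resolution.ExcellentRings
import Literature.AlgebraicGeometry.Resolution.VPreparedLabelShear
import Literature.AlgebraicGeometry.Resolution.AxialUnitChainLaw
import HarnessLib

/-!
# Cossart–Piltant 2008, Prop. 4.4 — T1 FROM PHASE A AND THE RING CONTRACT (the T1 skeleton v1.1, oracle form, sorry-free)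

OURS (res-inputs-p-8b g2; = `T1_of_bricks` of the T1 SKELETON v1.1 73f54af9a28e2ef0 with its two remaining slots turned into HYPOTHESES, in the
style of `orderReducible_comap_of_isolated_tau_one_of_T1`). **GIVEN** (oracle `hN2`) res-inputs-p-7b's RING CONTRACT v2 d8a51aeaad16ab3e
`false_of_unitChain_tau_one_rational` (binders VERBATIM; architecture (B): B0/B0′/B1 ✓ p625039, B2 ✓ p625256, B3–B6 open) and (oracle `hA`, for THIS
chain) PHASE A = the β-descent tail (res-inputs-p-8b, open: from some point step `n₀` on every point step is a rational `u`-chart point for the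
exceptional parameter `u` transported from an adapted prepared label at `x_{n₀}`), the chain of `τ = 1` near points of
`stub_T1_false_of_nearChain_tau_one` (SIGNATURES v4 l.340, binders VERBATIM) is IMPOSSIBLE: the contract is applied to the shifted stalk chain
`k ↦ 𝒪_{x_{n₀+k}}` and each of its clauses is discharged from the tree — order/τ/G-ring bookkeeping and quasi-isolation (Stacks 01J7 glue), the
weak transform as a colon, `hpoint` = σ (p626364) + TAIL, `hcurve` = κ (p624926) ∘ bridge (p627247), `hqis`, `hPsucc_pt` = line centre (p627545
∘ p623553), `hPsucc_cv` = κ″ (p626243) ∘ κ ∘ T1-α (p623079). Cossart–Piltant p. 11: «we get a sequence of points `x_{σ(i)}` … `τ(x_{σ(i)}) = 1`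
for all `i ≥ 0` … a contradiction». AI-written; AI review weaker than expert review. `CossartPiltant2008_prop44`, T1, phase A and the contract are
NOT proved here; resolution in dimension `≥ 4` / positive characteristic is NOT proved. No definitions, no named facts (the oracles are hypotheses).
-/

noncomputable section

open CategoryTheory CategoryTheory.Limits AlgebraicGeometry TopologicalSpace IsLocalRing MvPolynomial
open Literature.AlgebraicGeometry.Resolution Scheme.IdealSheafData

namespace Summit.ResolutionOfSingularities.ResolutionOfSingularities.Theorems

namespace CP2008Prop44

universe u

/-- **T1 FROM PHASE A AND THE RING CONTRACT (oracle form).** `hN2` = CONTRACT v2 `false_of_unitChain_tau_one_rational` (p-7b) as a hypothesis;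
then the binders of `stub_T1_false_of_nearChain_tau_one` (SIGNATURES v4 l.340) VERBATIM; then `hA` = PHASE A's conclusion for this chain
(`∃ n₀ u c₀, …`: a point step `n₀`, a regular system `c₀` with `c₀ 1 = u 0` and `L < δs`, `u` transported, and at every later level the
centre ideal extends to `(φ u_k)` with no residue field growth) ⊢ `False`. [cite: CossartPiltant2008, Prop. 4.4 (proof, p. 11), Lemma 4.5]
[cite: CossartJannsenSaito2020, Thm. 13.7] -/
theorem T1_of_phaseA_of_N2
    (hN2 : ∀ (Rn : ℕ → Type u) [∀ n, CommRing (Rn n)] [∀ n, IsRegularLocalRing (Rn n)]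
    (hdim : ∀ n, ringKrullDim (Rn n) = 3) (φ : ∀ n, Rn n →+* Rn (n + 1)) [∀ n, IsLocalHom (φ n)]
    (I : ∀ n, Ideal (Rn n)) {μ : ℕ} (hμ : 1 ≤ μ) (u : ∀ n, Rn n) (hu : ∀ n, u (n + 1) = φ n (u n))
    (pt : ℕ → Prop) (hpt0 : pt 0)
    -- level `0`: excellence, isolation, an adapted label `(c₀ 0, u 0, c₀ 2)`
    (hG : IsGRing (Rn 0))
    (hisol : ∀ (𝔮 : Ideal (Rn 0)) [𝔮.IsPrime], 𝔮 ≠ maximalIdeal (Rn 0) →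
      ¬ (I 0).map (algebraMap (Rn 0) (Localization.AtPrime 𝔮)) ≤ maximalIdeal (Localization.AtPrime 𝔮) ^ μ)
    (c₀ : Fin 3 → Rn 0) (hc₀ : Ideal.span {c₀ 0, c₀ 1, c₀ 2} = maximalIdeal (Rn 0)) (hc₀u : c₀ 1 = u 0)
    (hδ₀ : μ.factorial < deltaS c₀ (I 0) μ)
    -- every level: near, order exactly `μ`, `τ = 1`, rational, weak transform (EQUALITY with the colon)
    (hIμ : ∀ n, I n ≤ maximalIdeal (Rn n) ^ μ) (hIne : ∀ n, ¬ I n ≤ maximalIdeal (Rn n) ^ (μ + 1))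
    (hτ : ∀ n (c : Fin 3 → Rn n), Ideal.span {c 0, c 1, c 2} = maximalIdeal (Rn n) →
      hironakaTauAt c (I n) μ = 1)
    (hres : ∀ n, Function.Surjective (ResidueField.map (φ n)))
    (hI : ∀ n, I (n + 1) = ((I n).map (φ n)).colon {φ n (u n) ^ μ})
    -- POINT steps of the tail (`hconst`): u-chart, RATIONAL of type `(1 : λ)`, for EVERY adapted label
    (hpoint : ∀ n, pt n → ∀ (y w : Rn n), Ideal.span {y, u n, w} = maximalIdeal (Rn n) →
      (∀ G ∈ initialForms ![y, u n, w] (I n) μ, ∃ a : ResidueField (Rn n), G = C a * X 0 ^ μ) →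
      ∃ (a : Rn n) (y' w' : Rn (n + 1)), φ n y = φ n (u n) * y' ∧ φ n (w - a * u n) = φ n (u n) * w' ∧
        Ideal.span {y', φ n (u n), w'} = maximalIdeal (Rn (n + 1)))
    -- CURVE steps: centre prime, permissibility, chart for EVERY presentation `(y, u_n)` of the centre
    (P : ∀ n, Ideal (Rn n)) (hIP : ∀ n, ¬ pt n → I n ≤ P n ^ μ)
    (hcurve : ∀ n, ¬ pt n → ∀ (y w : Rn n), Ideal.span {y, u n} = P n →
      Ideal.span {y, u n, w} = maximalIdeal (Rn n) →
      (∀ G ∈ initialForms ![y, u n, w] (I n) μ, ∃ a : ResidueField (Rn n), G = C a * X 0 ^ μ) →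
      ∃ y' : Rn (n + 1), φ n y = φ n (u n) * y' ∧
        Ideal.span {y', φ n (u n), φ n w} = maximalIdeal (Rn (n + 1)))
    -- quasi-isolation at EVERY level, relative to the centre (critic R65 (1)(c); point steps: `pt n ∨ …`)
    (hqis : ∀ n (𝔮 : Ideal (Rn n)) [𝔮.IsPrime], 𝔮 ≠ maximalIdeal (Rn n) → (pt n ∨ 𝔮 ≠ P n) →
      ¬ (I n).map (algebraMap (Rn n) (Localization.AtPrime 𝔮)) ≤ maximalIdeal (Localization.AtPrime 𝔮) ^ μ)
    -- after a POINT step the next centre (if a curve) is the line `L_{x_n} = V(u, y′)` (ρ1; well-defined)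
    (hPsucc_pt : ∀ n, pt n → ¬ pt (n + 1) → ∀ (y w : Rn n) (y' : Rn (n + 1)),
      Ideal.span {y, u n, w} = maximalIdeal (Rn n) →
      (∀ G ∈ initialForms ![y, u n, w] (I n) μ, ∃ a : ResidueField (Rn n), G = C a * X 0 ^ μ) →
      φ n y = φ n (u n) * y' → Ideal.span {y', u (n + 1)} = P (n + 1))
    -- after a CURVE step the next centre (if a curve) is the strict transform of the centre, up to a
    -- correction `β ∈ 𝔪_n` of the presentation (critic R65 (1)(b) = p-8b's (P2), byte-verbatim)
    (hPsucc_cv : ∀ n, ¬ pt n → ¬ pt (n + 1) → ∀ (y w : Rn n) (y' : Rn (n + 1)),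
      Ideal.span {y, u n} = P n →
      Ideal.span {y, u n, w} = maximalIdeal (Rn n) →
      (∀ G ∈ initialForms ![y, u n, w] (I n) μ, ∃ a : ResidueField (Rn n), G = C a * X 0 ^ μ) →
      φ n y = φ n (u n) * y' →
      u (n + 1) ∈ P (n + 1) ∧ ∃ β ∈ maximalIdeal (Rn n), Ideal.span {y' + φ n β, u (n + 1)} = P (n + 1)),
      False)
    (Xs : ℕ → Scheme.{u})
    (hN : ∀ n, IsLocallyNoetherian (Xs n)) (hXreg : ∀ n, Scheme.IsRegular (Xs n))
    (π : ∀ n, Xs (n + 1) ⟶ Xs n) (Y : ∀ n, Closeds (Xs n)) (y : ∀ n, Xs (n + 1))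
    (J : ∀ n, (Xs n).IdealSheafData) {μ : ℕ} (hμ : 1 ≤ μ)
    (hy : ∀ n, π (n + 1) (y (n + 1)) = y n)
    (hmem : ∀ n, π n (y n) ∈ (Y n : Set (Xs n)))
    (hcl : ∀ n, IsClosed ({π n (y n)} : Set (Xs n)))
    (hYirr : ∀ n, IsIrreducible ((Y n : Closeds (Xs n)) : Set (Xs n)))
    (hYreg : ∀ n, Scheme.IsRegular (vanishingIdeal (Y n)).subscheme)
    (hYord : ∀ n, ∀ z ∈ (Y n : Set (Xs n)), idealOrder (J n) z = μ)
    (hπ : ∀ n, IsBlowup (π n) (vanishingIdeal (Y n)))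
    (hJ : ∀ n, J (n + 1) = controlledTransform (π n) (vanishingIdeal (Y n)) (J n) μ)
    (hbd : ∀ n (z : Xs n), idealOrder (J n) z ≤ μ)
    (hcodim : ∀ n, ∀ z ∈ (J n).support, 1 < Order.coheight z)
    (hd : ∀ n, (maximalIdeal ((Xs n).presheaf.stalk (π n (y n)))).spanFinrank = 3)
    (hnear : ∀ n, IsNear (π n) (vanishingIdeal (Y n)) (J n) μ (y n))
    (hτ : ∀ n, @stalkTau (Xs n) (J n) (π n (y n)) (hXreg n (π n (y n))) μ = 1)
    (hG : ∀ n, IsGRing ((Xs n).presheaf.stalk (π n (y n))))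
    (hcoinc : ∀ n (z : Xs n), z ⤳ π n (y n) → idealOrder (J n) z = μ → z ∈ (Y n : Set (Xs n)))
    (hA :
      ∃ (n₀ : ℕ) (u : ∀ k, chainRing Xs π y (n₀ + k)) (c₀ : Fin 3 → chainRing Xs π y n₀),
        (Y n₀ : Set (Xs n₀)) = {π n₀ (y n₀)} ∧
        Ideal.span {c₀ 0, c₀ 1, c₀ 2} = maximalIdeal _ ∧ c₀ 1 = u 0 ∧
        μ.factorial < deltaS c₀ (chainIdeal Xs π y J n₀) μ ∧
        (∀ k, u (k + 1) = chainMap Xs π y hy (n₀ + k) (u k)) ∧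
        ∀ k, (stalkIdeal (vanishingIdeal (Y (n₀ + k))) (π (n₀ + k) (y (n₀ + k)))).map (chainMap Xs π y hy (n₀ + k)) =
            Ideal.span {chainMap Xs π y hy (n₀ + k) (u k)} ∧
          Function.Surjective (ResidueField.map (chainMap Xs π y hy (n₀ + k)))) :
    False := by
  classical
  haveI := hN
  haveI hR : ∀ n, IsRegularLocalRing (chainRing Xs π y n) := fun n => hXreg n _
  -- ranges of triples
  have rangeFin3 : ∀ {α : Type u} (c : Fin 3 → α), Set.range c = {c 0, c 1, c 2} := by
    intro α c
    ext a
    simp only [Set.mem_range, Set.mem_insert_iff, Set.mem_singleton_iff]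
    constructor
    · rintro ⟨i, rfl⟩
      fin_cases i
      · exact Or.inl rfl
      · exact Or.inr (Or.inl rfl)
      · exact Or.inr (Or.inr rfl)
    · rintro (h | h | h) <;> exact ⟨_, h.symm⟩
  have range3 : ∀ {α : Type u} (a b c : α), Set.range ![a, b, c] = {a, b, c} := by
    intro α a b c
    rw [rangeFin3]; rfl
  -- order exactly `μ` at `x_n`, dimension, `τ = 1`
  have hordx : ∀ n, idealOrder (J n) (π n (y n)) = μ := fun n => hYord n _ (hmem n)
  have hIμ : ∀ n, chainIdeal Xs π y J n ≤ maximalIdeal _ ^ μ := fun n =>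
    (le_idealOrder_iff (J n) (π n (y n)) μ).mp (hordx n).ge
  have hIne : ∀ n, ¬ chainIdeal Xs π y J n ≤ maximalIdeal _ ^ (μ + 1) := by
    intro n h
    have h' := (le_idealOrder_iff (J n) (π n (y n)) (μ + 1)).mpr h
    rw [hordx n] at h'
    exact absurd (by exact_mod_cast h' : μ + 1 ≤ μ) (by omega)
  have hdim : ∀ n, ringKrullDim (chainRing Xs π y n) = 3 := by
    intro n
    have h := (isRegularLocalRing_iff (chainRing Xs π y n)).mp inferInstance
    rw [hd n] at h
    exact_mod_cast h.symm
  have hτr : ∀ n (c : Fin 3 → chainRing Xs π y n), Ideal.span (Set.range c) = maximalIdeal _ →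
      hironakaTauAt c (chainIdeal Xs π y J n) μ = 1 := by
    intro n c hc
    rw [chainIdeal, ← stalkTau_eq (J n) (π n (y n)) μ (hd n) c hc]
    exact hτ n
  have hτ3 : ∀ n (c : Fin 3 → chainRing Xs π y n), Ideal.span {c 0, c 1, c 2} = maximalIdeal _ →
      hironakaTauAt c (chainIdeal Xs π y J n) μ = 1 := fun n c hc => hτr n c (by rw [rangeFin3]; exact hc)
  -- centre ideals and quasi-isolation
  have hIP : ∀ n, chainIdeal Xs π y J n ≤ stalkIdeal (vanishingIdeal (Y n)) (π n (y n)) ^ μ := by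
    intro n
    rw [chainIdeal, ← stalkIdeal_pow]
    exact stalkIdeal_mono (le_vanishingIdeal_pow_of_forall_idealOrder_eq (hXreg n) (hYreg n) (hYord n)) _
  have hpt_P : ∀ n, (Y n : Set (Xs n)) = {π n (y n)} → stalkIdeal (vanishingIdeal (Y n)) (π n (y n)) = maximalIdeal _ := by
    intro n hn
    have hYn : Y n = ⟨{π n (y n)}, hcl n⟩ := Closeds.ext hn
    rw [hYn, stalkIdeal_vanishingIdeal_singleton (hcl n)]
  have hqis : ∀ n (𝔮 : Ideal (chainRing Xs π y n)) [𝔮.IsPrime], 𝔮 ≠ maximalIdeal _ →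
      𝔮 ≠ stalkIdeal (vanishingIdeal (Y n)) (π n (y n)) →
      ¬ (chainIdeal Xs π y J n).map (algebraMap _ (Localization.AtPrime 𝔮)) ≤ maximalIdeal (Localization.AtPrime 𝔮) ^ μ := by
    intro n 𝔮 _ h𝔮 h𝔮P hle
    obtain ⟨ζ, hζx, hP⟩ := exists_specializes_comap_stalkSpecializes_eq (π n (y n)) 𝔮
    have hζne : ζ ≠ π n (y n) := by
      intro heq
      subst heq
      exact h𝔮 (hP.trans (comap_stalkSpecializes_refl_maximalIdeal _))
    subst hP
    have hord : (μ : ℕ∞) ≤ idealOrder (J n) ζ := le_idealOrder_of_map_le_pow (J n) hζx μ hle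
    have hζY : ζ ∈ (Y n : Set (Xs n)) := hcoinc n ζ hζx (le_antisymm (hbd n ζ) hord)
    have hYne : (Y n : Set (Xs n)) ≠ {π n (y n)} := fun h => hζne (by rw [h] at hζY; exact hζY)
    obtain ⟨hYη, -, hηx, -, -, hgen⟩ := genericPoint_curve_facts (hXreg n) hμ (hcodim n) (hYirr n) (hYord n) (hmem n) (hcl n) (hd n) hYne
    rcases hgen ζ hζY hζx with h | h
    · exact hζne h
    · apply h𝔮P
      have hYc : Y n = ⟨closure {(hYirr n).genericPoint}, isClosed_closure⟩ := Closeds.ext hYη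
      rw [hYc, stalkIdeal_vanishingIdeal_closure hηx]
      subst h
      rfl
  -- PHASE A: the rational `u`-chart tail from the point step `n₀` on
  obtain ⟨n₀, u, c₀, hpt₀, hc₀, hc₀u, hδ₀, hu, htail⟩ := hA
  -- σ at the POINT steps of the tail: only case (i)/(ii) survives TAIL
  have hσpt : ∀ k, (Y (n₀ + k) : Set (Xs (n₀ + k))) = {π (n₀ + k) (y (n₀ + k))} → ∀ (yv wv : chainRing Xs π y (n₀ + k)),
      Ideal.span {yv, u k, wv} = maximalIdeal _ →
      (∀ G ∈ initialForms ![yv, u k, wv] (chainIdeal Xs π y J (n₀ + k)) μ, ∃ a : ResidueField (chainRing Xs π y (n₀ + k)), G = C a * X 0 ^ μ) →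
      ∃ (a : chainRing Xs π y (n₀ + k)) (c' : Fin 3 → chainRing Xs π y (n₀ + k + 1)),
        c' 1 = chainMap Xs π y hy (n₀ + k) (u k) ∧
        chainMap Xs π y hy (n₀ + k) yv = chainMap Xs π y hy (n₀ + k) (u k) * c' 0 ∧
        chainMap Xs π y hy (n₀ + k) (wv - a * u k) = chainMap Xs π y hy (n₀ + k) (u k) * c' 2 ∧
        Ideal.span {c' 0, c' 1, c' 2} = maximalIdeal _ := by
    intro k hptk yv wv hgen had
    set c : Fin 3 → chainRing Xs π y (n₀ + k) := ![yv, u k, wv] with hc_def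
    have hc : Ideal.span (Set.range c) = maximalIdeal _ := by rw [hc_def, range3]; exact hgen
    have hcY : Ideal.span (Set.range c) = stalkIdeal (vanishingIdeal (Y (n₀ + k))) (π (n₀ + k) (y (n₀ + k))) := by
      rw [hc, hpt_P _ hptk]
    have hadI : ∀ i, i ≠ 0 → IsAdapted c (chainIdeal Xs π y J (n₀ + k)) μ i := bridge_isAdapted had
    have h𝔪map : (maximalIdeal (chainRing Xs π y (n₀ + k))).map (chainMap Xs π y hy (n₀ + k)) =
        Ideal.span {chainMap Xs π y hy (n₀ + k) (u k)} := by
      rw [← hpt_P _ hptk]; exact (htail k).1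
    have hcM : chainMap Xs π y hy (n₀ + k) = stalkMapCongr (π (n₀ + k)) (y (n₀ + k)) (π (n₀ + k + 1) (y (n₀ + k + 1))) (hy (n₀ + k)) := rfl
    rcases sigma_congr (hπ (n₀ + k)) hμ (hd (n₀ + k)) hc hcY (hτ (n₀ + k)) hadI (hnear (n₀ + k))
        (π (n₀ + k + 1) (y (n₀ + k + 1))) (hy (n₀ + k)) (hd (n₀ + k + 1)) with
      ⟨a, c', h1, h0, h2, hgen', -, -⟩ | ⟨t, P, c', -, -, -, -, -, hdeg, -, hres, -, -⟩ | ⟨c', h2, -, h1, hgen', -, -⟩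
    · -- (i)/(ii): the rational `u`-chart point
      refine ⟨a, c', ?_, ?_, ?_, hgen'⟩
      · rw [hcM]; simpa [hc_def] using h1
      · rw [hcM]; simpa [hc_def] using h0
      · rw [hcM]; simpa [hc_def] using h2
    · -- (iii): non-rational — contradicts the rational tail
      exact absurd (htail k).2 (not_surjective_residueField_map_of_two_le_natDegree _ hdeg hres)
    · -- (i′): the `u₂`-chart origin — contradicts `𝔪𝒪′ = (φ u)`
      exfalso
      set φk := stalkMapCongr (π (n₀ + k)) (y (n₀ + k)) (π (n₀ + k + 1) (y (n₀ + k + 1))) (hy (n₀ + k)) with hφk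
      have hc1 : c 1 = u k := by simp [hc_def]
      have hc'1 : c' 1 ∈ maximalIdeal _ := hgen' ▸ Ideal.subset_span (by simp)
      have hφc2 : φk (c 2) ∈ Ideal.span {φk (c 1)} := by
        rw [hc1, ← hcM, ← h𝔪map]; exact Ideal.mem_map_of_mem _ (hc ▸ Ideal.subset_span ⟨2, rfl⟩)
      obtain ⟨r, hr⟩ := Ideal.mem_span_singleton'.mp hφc2
      rw [h1] at hr
      have hzero : φk (c 2) = 0 := by
        have hunit : IsUnit (1 - r * c' 1) :=
          IsLocalRing.isUnit_one_sub_self_of_mem_nonunits _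
            ((IsLocalRing.mem_maximalIdeal _).mp (Ideal.mul_mem_left _ r hc'1))
        have : φk (c 2) * (1 - r * c' 1) = 0 := by
          rw [mul_sub, mul_one, sub_eq_zero]
          calc φk (c 2) = r * (φk (c 2) * c' 1) := hr.symm
            _ = φk (c 2) * (r * c' 1) := by ring
        exact (hunit.mul_left_eq_zero).mp this
      rw [hzero] at h2
      rw [h2, Set.pair_comm (c' 1) (0 : chainRing Xs π y (n₀ + k + 1)), Set.insert_comm (c' 0) 0, Ideal.span,
        Submodule.span_insert_zero] at hgen'
      exact false_of_span_pair_eq_maximalIdeal hgen' (hd (n₀ + k + 1))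
  -- THE CONTRACT on the shifted chain
  refine hN2 (fun k => chainRing Xs π y (n₀ + k)) (fun k => hdim (n₀ + k)) (fun k => chainMap Xs π y hy (n₀ + k))
    (fun k => chainIdeal Xs π y J (n₀ + k)) hμ u hu (fun k => (Y (n₀ + k) : Set (Xs (n₀ + k))) = {π (n₀ + k) (y (n₀ + k))}) hpt₀
    (hG n₀) ?_ c₀ hc₀ hc₀u hδ₀ (fun k => hIμ (n₀ + k)) (fun k => hIne (n₀ + k)) (fun k => hτ3 (n₀ + k)) (fun k => (htail k).2) ?_ ?_
    (fun k => stalkIdeal (vanishingIdeal (Y (n₀ + k))) (π (n₀ + k) (y (n₀ + k)))) (fun k _ => hIP (n₀ + k)) ?_ ?_ ?_ ?_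
  · -- isolation at the first point step
    intro 𝔮 _ h𝔮
    exact hqis n₀ 𝔮 h𝔮 (by rw [hpt_P n₀ hpt₀]; exact h𝔮)
  · -- the weak transform is the colon by `(φ u)^μ`
    intro k
    change stalkIdeal (J (n₀ + k + 1)) (π (n₀ + k + 1) (y (n₀ + k + 1))) = _
    rw [hJ (n₀ + k)]
    exact stalkIdeal_controlledTransform_eq_colon_congr (Y (n₀ + k)) (J (n₀ + k)) μ _ (hy (n₀ + k)) (u k) (htail k).1
  · -- POINT steps: σ + TAIL
    intro k hptk yv wv hgen had
    show ∃ (a : chainRing Xs π y (n₀ + k)) (y' w' : chainRing Xs π y (n₀ + k + 1)),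
      chainMap Xs π y hy (n₀ + k) yv = chainMap Xs π y hy (n₀ + k) (u k) * y' ∧
      chainMap Xs π y hy (n₀ + k) (wv - a * u k) = chainMap Xs π y hy (n₀ + k) (u k) * w' ∧
      Ideal.span {y', chainMap Xs π y hy (n₀ + k) (u k), w'} = maximalIdeal (chainRing Xs π y (n₀ + k + 1))
    obtain ⟨a, c', h1, h0, h2, hgen'⟩ := hσpt k hptk yv wv hgen had
    exact ⟨a, c' 0, c' 2, h0, h2, by rw [h1] at hgen'; exact hgen'⟩
  · -- CURVE steps: κ ∘ bridge
    intro k hnpt yv wv hyu hgen had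
    show ∃ y' : chainRing Xs π y (n₀ + k + 1), chainMap Xs π y hy (n₀ + k) yv = chainMap Xs π y hy (n₀ + k) (u k) * y' ∧
      Ideal.span {y', chainMap Xs π y hy (n₀ + k) (u k), chainMap Xs π y hy (n₀ + k) wv} = maximalIdeal (chainRing Xs π y (n₀ + k + 1))
    set c : Fin 3 → chainRing Xs π y (n₀ + k) := ![yv, u k, wv] with hc_def
    have hc : Ideal.span (Set.range c) = maximalIdeal _ := by rw [hc_def, range3]; exact hgen
    have hcY : Ideal.span {c 0, c 1} = stalkIdeal (vanishingIdeal (Y (n₀ + k))) (π (n₀ + k) (y (n₀ + k))) := by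
      simp only [hc_def, Matrix.cons_val_zero, Matrix.cons_val_one]; exact hyu
    have hadI : ∀ i, i ≠ 0 → IsAdapted c (chainIdeal Xs π y J (n₀ + k)) μ i := bridge_isAdapted had
    have hcM : chainMap Xs π y hy (n₀ + k) = stalkMapCongr (π (n₀ + k)) (y (n₀ + k)) (π (n₀ + k + 1) (y (n₀ + k + 1))) (hy (n₀ + k)) := rfl
    obtain ⟨c', -, h1, h0, h2, hgen', -, -⟩ :=
      IsBlowup.exists_curveStepData_of_adapted_congr (hXreg (n₀ + k)) (hYreg (n₀ + k)) (hπ (n₀ + k)) hμ (hYord (n₀ + k)) (hd (n₀ + k))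
        hc hcY (hτ (n₀ + k)) hadI (hnear (n₀ + k)) (π (n₀ + k + 1) (y (n₀ + k + 1))) (hy (n₀ + k))
    refine ⟨c' 0, ?_, ?_⟩
    · rw [hcM]; simpa [hc_def] using h0
    · rw [h1, h2] at hgen'
      rw [hcM]
      simp only [hc_def, Matrix.cons_val_one, Matrix.head_cons, Matrix.cons_val_zero, Matrix.cons_val_two, Matrix.tail_cons] at hgen'
      convert hgen' using 2
  · -- quasi-isolation relative to the centre
    intro k 𝔮 _ h𝔮 hor
    refine hqis (n₀ + k) 𝔮 h𝔮 ?_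
    rcases hor with hptk | hne
    · rw [hpt_P _ hptk]; exact h𝔮
    · exact hne
  · -- POINT → CURVE: the line centre
    intro k hptk hnpt1 yv wv y' hgen had hrel
    show Ideal.span {y', u (k + 1)} = stalkIdeal (vanishingIdeal (Y (n₀ + k + 1))) (π (n₀ + k + 1) (y (n₀ + k + 1)))
    haveI : IsDomain (chainRing Xs π y (n₀ + k + 1)) := isDomain_of_isRegularLocalRing _
    have hchart : (maximalIdeal (chainRing Xs π y (n₀ + k))).map (chainMap Xs π y hy (n₀ + k)) =
        Ideal.span {chainMap Xs π y hy (n₀ + k) (u k)} := by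
      rw [← hpt_P _ hptk]; exact (htail k).1
    obtain ⟨a, c', h1, h0, -, hgen'⟩ := hσpt k hptk yv wv hgen had
    -- `φ u ≠ 0`, `y′ = c′ 0`, `(φ u, y′)` an rsop pair
    have hφu : chainMap Xs π y hy (n₀ + k) (u k) ≠ 0 := by
      intro h0'
      rw [h1, h0', Set.insert_comm (c' 0) 0, Ideal.span, Submodule.span_insert_zero] at hgen'
      exact false_of_span_pair_eq_maximalIdeal hgen' (hd (n₀ + k + 1))
    have hy' : y' = c' 0 := mul_left_cancel₀ hφu (hrel.symm.trans h0)
    have range1 : ∀ t : chainRing Xs π y (n₀ + k + 1), Set.range ![t] = {t} := fun t => by ext s; simp [eq_comm]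
    have range2 : ∀ a b : chainRing Xs π y (n₀ + k + 1), Set.range ![a, b] = {a, b} := by
      intro a b; ext t
      simp only [Set.mem_range, Set.mem_insert_iff, Set.mem_singleton_iff]
      constructor
      · rintro ⟨i, rfl⟩
        fin_cases i
        · exact Or.inl rfl
        · exact Or.inr rfl
      · rintro (h | h)
        · exact ⟨0, by simp [h]⟩
        · exact ⟨1, by simp [h]⟩
    have hrsop : IsRsopPart ![chainMap Xs π y hy (n₀ + k) (u k), y'] := by
      refine ⟨inferInstance, 1, ![c' 2], by rw [hdim]; rfl, ?_⟩
      rw [range2, range1, ← hgen', h1, hy', Set.union_singleton, Set.insert_comm (c' 2), Set.pair_comm (c' 2),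
        Set.insert_comm (chainMap Xs π y hy (n₀ + k) (u k)) (c' 0)]
    have h := lineCentre_chain Xs hN hXreg π Y y J hμ hy hmem hcl hYirr hYreg hYord hπ hJ hbd hcodim hd hnear hτ hG hcoinc (n₀ + k)
      hptk hnpt1 yv (u k) wv y' hgen (bridge_isAdapted had) hchart hrel hrsop
    rw [hu k]; exact h
  · -- CURVE → CURVE: κ″ ∘ κ ∘ T1-α
    intro k hnpt hnpt1 yv wv y' hyu hgen had hrel
    show u (k + 1) ∈ stalkIdeal (vanishingIdeal (Y (n₀ + k + 1))) (π (n₀ + k + 1) (y (n₀ + k + 1))) ∧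
      ∃ β ∈ maximalIdeal (chainRing Xs π y (n₀ + k)),
        Ideal.span {y' + chainMap Xs π y hy (n₀ + k) β, u (k + 1)} = stalkIdeal (vanishingIdeal (Y (n₀ + k + 1))) (π (n₀ + k + 1) (y (n₀ + k + 1)))
    haveI : IsDomain (chainRing Xs π y (n₀ + k + 1)) := isDomain_of_isRegularLocalRing _
    -- T1-α: the generic point of `Y (n+1)` is the near point over the generic point of `Y n`
    obtain ⟨hπζ, hζnear, hYζ, hcohη, hcohζ⟩ :=
      tauOneChain_curveStep_succ Xs hN hXreg π Y y J hμ hy hmem hcl hYirr hYreg hYord hπ hJ hcodim hd hcoinc (n₀ + k) hnpt hnpt1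
    obtain ⟨hYη, -, -, -, -, -⟩ :=
      genericPoint_curve_facts (hXreg (n₀ + k)) hμ (hcodim (n₀ + k)) (hYirr (n₀ + k)) (hYord (n₀ + k)) (hmem (n₀ + k)) (hcl (n₀ + k))
        (hd (n₀ + k)) hnpt
    have hζq : (hYirr (n₀ + k + 1)).genericPoint ⤳ π (n₀ + k + 1) (y (n₀ + k + 1)) :=
      specializes_iff_mem_closure.mpr (hYζ ▸ hmem (n₀ + k + 1))
    have hYη' : (Y (n₀ + k) : Set (Xs (n₀ + k))) = closure {π (n₀ + k) (hYirr (n₀ + k + 1)).genericPoint} := by rw [hπζ]; exact hYη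
    have hcohη' : Order.coheight (π (n₀ + k) (hYirr (n₀ + k + 1)).genericPoint) = 2 := by rw [hπζ]; exact hcohη
    -- κ for this adapted presentation
    set c : Fin 3 → chainRing Xs π y (n₀ + k) := ![yv, u k, wv] with hc_def
    have hc : Ideal.span (Set.range c) = maximalIdeal _ := by rw [hc_def, range3]; exact hgen
    have hcY : Ideal.span {c 0, c 1} = stalkIdeal (vanishingIdeal (Y (n₀ + k))) (π (n₀ + k) (y (n₀ + k))) := by
      simp only [hc_def, Matrix.cons_val_zero, Matrix.cons_val_one]; exact hyu
    have hadI : ∀ i, i ≠ 0 → IsAdapted c (chainIdeal Xs π y J (n₀ + k)) μ i := bridge_isAdapted had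
    have hcM : chainMap Xs π y hy (n₀ + k) = stalkMapCongr (π (n₀ + k)) (y (n₀ + k)) (π (n₀ + k + 1) (y (n₀ + k + 1))) (hy (n₀ + k)) := rfl
    obtain ⟨c', -, h1, h0, h2, hgen', -, -⟩ :=
      IsBlowup.exists_curveStepData_of_adapted_congr (hXreg (n₀ + k)) (hYreg (n₀ + k)) (hπ (n₀ + k)) hμ (hYord (n₀ + k)) (hd (n₀ + k))
        hc hcY (hτ (n₀ + k)) hadI (hnear (n₀ + k)) (π (n₀ + k + 1) (y (n₀ + k + 1))) (hy (n₀ + k))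
    simp only [hc_def, Matrix.cons_val_one, Matrix.head_cons, Matrix.cons_val_zero, Matrix.cons_val_two, Matrix.tail_cons] at h1 h0 h2
    -- `φ u ≠ 0` (else `𝔪′` would be 2-generated), hence `y′ = c′ 0`
    have hφu : chainMap Xs π y hy (n₀ + k) (u k) ≠ 0 := by
      intro h0'
      rw [h1, ← hcM, h0', Set.insert_comm (c' 0) 0, Ideal.span, Submodule.span_insert_zero] at hgen'
      exact false_of_span_pair_eq_maximalIdeal hgen' (hd (n₀ + k + 1))
    have h0c : chainMap Xs π y hy (n₀ + k) yv = chainMap Xs π y hy (n₀ + k) (u k) * c' 0 := by rw [hcM]; exact h0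
    have hy' : y' = c' 0 := mul_left_cancel₀ hφu (hrel.symm.trans h0c)
    rw [h1, h2, ← hy'] at hgen'
    have hrel' : stalkMapCongr (π (n₀ + k)) (y (n₀ + k)) (π (n₀ + k + 1) (y (n₀ + k + 1))) (hy (n₀ + k)) yv =
        stalkMapCongr (π (n₀ + k)) (y (n₀ + k)) (π (n₀ + k + 1) (y (n₀ + k + 1))) (hy (n₀ + k)) (u k) * y' := by
      rw [← hcM]; exact hrel
    obtain ⟨hmemu, β, hβ, hspan⟩ :=
      curveStep_succ_centre_congr (hXreg (n₀ + k)) (hYreg (n₀ + k)) (hπ (n₀ + k)) hμ (hYord (n₀ + k)) (π (n₀ + k + 1) (y (n₀ + k + 1)))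
        (hy (n₀ + k)) (hd (n₀ + k)) (hd (n₀ + k + 1)) hζq hcohζ hcohη' hYη' hζnear (Y' := Y (n₀ + k + 1)) hYζ hgen hyu hrel' hgen'
    rw [hu k, hcM]
    exact ⟨hmemu, β, hβ, hspan⟩

end CP2008Prop44

end Summit.ResolutionOfSingularities.ResolutionOfSingularities.Theorems

end
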